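import Literature.NumberTheory.EllipticCurves.PAdicLFunctionMinusMultDistributionProofs
import Literature.NumberTheory.EllipticCurves.PAdicLFunctionMinusDistributionProofs
import HarnessLib

/-!
# The `ω^i`-branches of the Mellin transform of a bounded distribution converge and are bounded

`PAdicMeasureTransform` proves, for an abstract family `μ : (n : ℕ) → ℤ/pⁿ → ℚ_p` satisfying the
distribution relation and a bound `‖μ‖ ≤ C`, that the Riemann sums
`RS k n = ∑_ζ ∑_{s mod pⁿ} μ(ζ γˢ + p^{n+e₀}ℤ_p) (s choose k)` of the TRIVIAL branch converge
(`tendsto_riemannSum_of_distribution`) with limit of norm `≤ C`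
(`norm_limUnder_riemannSum_le_of_distribution`) — Mazur–Tate–Teitelbaum 1986, §I.11–I.13. The
`ω^i`-BRANCHES `∫_{ℤ_p^×} ω^i(x) (ℓ(x) choose k) dμ(x)`, whose Riemann sums carry the extra weight
`ζ^i` (tree: `padicLBranchRiemannSum`, `padicLMinusBranchRiemannSum`, `padicLMinusBranchMultRiemannSum`;
MTT §I.13, `L_p(P, χ)` for a tame character `χ = ω^i`), were so far only evaluated at `k = 0`
(`padicLBranchCoeff_zero_eq`, `padicLMinusBranchCoeff_zero_eq`). This file reduces the branches to
the trivial-branch theory, with NO new analysis: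

* `branchTwist i μ` (definition): the family `ω^i · μ` — at level `n` the push-down
  `a + pⁿℤ_p ↦ ∑_{b ≡ a (pⁿ), b mod p^{e₀+n}} μ(b + p^{e₀+n}ℤ_p) ω(b)^i` (`ω(b)^i = teichWeight p i (b mod p^{e₀})`,
  which only depends on `b mod p^{e₀}`; pushing down `e₀` levels makes the family a distribution at
  EVERY level, including the levels `< e₀` where `ω` is not defined on `ℤ/pⁿ`);
* `branchTwist_distribution`, `norm_branchTwist_le`: it is again a distribution, bounded by the same `C`
  (`‖ω(b)^i‖ ≤ 1`, `norm_teichWeight_le_one`);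
* `branchTwist_apply_of_distribution`: at levels `m ≥ e₀`, `(ω^i μ)(u + p^mℤ_p) = μ(u + p^mℤ_p) ω(u)^i`
  (iterated distribution relation `sum_fiber_of_distribution`), so by `teichWeight_classMap`
  (`ω(ζ γˢ)^i = ζ^i`) the weighted Riemann sums of `μ` ARE the plain Riemann sums of `ω^i μ`
  (`weightedRiemannSum_eq`);
* hence (the tree's `tendsto_riemannSum_of_distribution` / `norm_limUnder_riemannSum_le_of_distribution`
  applied to `ω^i μ`; `norm_limUnder_weightedRiemannSum_le_of_forall_le`) the weighted Riemann sums
  converge, the limit has norm `≤ C`, and `≤ C'` whenever every Riemann sum has norm `≤ C'`;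
* specialisations to the tree's three measures (hypotheses: the distribution relation `hdist` and a
  bound `hC` of the measure, both available in the tree for rational newforms —
  `msdMeasure_distribution_holds`, `sum_fiber_msdMinusMeasure_succ_eq_of_coeffField`,
  `sum_fiber_msdMinusMeasureMult_succ_eq_of_coeffField`, `norm_msdMeasure_le_one`,
  `norm_msdMinusMeasure_le_one`, …): `tendsto_padicLBranchRiemannSum` / `norm_padicLBranchCoeff_le`,
  `tendsto_padicLMinusBranchRiemannSum` / `norm_padicLMinusBranchCoeff_le`,
  `tendsto_padicLMinusBranchMultRiemannSum` / `norm_padicLMinusBranchMultCoeff_le`.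

Motivation: residual cell `b2b-bsdres` — class O1 (X5 at `p = 2`), o1 lens-1 GEN 3 step S1
(`padicLFunctionMinusBranch_mem_integral_two`, file `PAdicLFunctionMinusIntegralityAtTwoProofs`), and
the additive-p4 line V9/V14 (odd branches at `p = 3`). Theorems + one auxiliary definition; no named
fact (D-0026).

## References

* B. Mazur, J. Tate, J. Teitelbaum, *On `p`-adic analogues of the conjectures of Birch and
  Swinnerton-Dyer*, Invent. Math. 84 (1986), 1–48: §I.11 (measures, (11.1)), §I.12
  (`Λ ⊗ ℚ` = bounded power series), §I.13 (the branches `L_p(P, χ)` at tame `χ = ω^i`).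
  [MazurTateTeitelbaum1986Invent]
* L. C. Washington, *Introduction to cyclotomic fields*, GTM 83, §5.1 (`ω`), §7.2, §12.2.
-/

noncomputable section

open Filter Topology

open scoped MatrixGroups

namespace Literature.NumberTheory.EllipticCurves

variable {p : ℕ} [Fact p.Prime]

/-! ### The `ω^i`-twisted family, pushed down `e₀` levels -/

section BranchTwist

variable {μ : (n : ℕ) → ZMod (p ^ n) → ℚ_[p]}

/-- The **`ω^i`-twist of a family `μ`**, pushed down `e₀ = cyclotomicExponent p` levels so that it is
defined (and a distribution) at every level:
`(ω^i μ)(a + pⁿℤ_p) := ∑_{b mod p^{e₀+n}, b ≡ a (pⁿ)} μ(b + p^{e₀+n}ℤ_p) · ω(b)^i`, with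
`ω(b)^i = teichWeight p i (b mod p^{e₀})` (`= 0` on non-units). For `n ≥ e₀` and `μ` a distribution it
is `μ(a + pⁿℤ_p) ω(a)^i` (`branchTwist_apply_of_distribution`): the measure `ω^i μ` whose Mellin
transform is the `ω^i`-branch `∫ ω^i (1+T)^{ℓ(x)} dμ` (Mazur–Tate–Teitelbaum 1986, §I.13, the tame
twist `P ↦ χ P`). [cite: MazurTateTeitelbaum1986Invent, §I.13] -/
def branchTwist (i : ℕ) (μ : (n : ℕ) → ZMod (p ^ n) → ℚ_[p]) (n : ℕ) (a : ZMod (p ^ n)) : ℚ_[p] :=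
  ∑ b ∈ Finset.univ.filter (fun b : ZMod (p ^ (cyclotomicExponent p + n)) ↦
      ZMod.castHom (pow_dvd_pow p (Nat.le_add_left n _)) (ZMod (p ^ n)) b = a),
    μ (cyclotomicExponent p + n) b *
      teichWeight p i (ZMod.castHom (pow_dvd_pow p (Nat.le_add_right _ n))
        (ZMod (p ^ cyclotomicExponent p)) b)

variable (p) in
/-- `‖ω(a)^i‖ ≤ 1` (`ω(a)` is a `p`-adic unit, and the weight is `0` off the units).
[cite: MazurTateTeitelbaum1986Invent, §I.13] -/
theorem norm_teichWeight_le_one (i : ℕ) (a : ZMod (p ^ cyclotomicExponent p)) :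
    ‖teichWeight p i a‖ ≤ 1 := by
  unfold teichWeight
  split_ifs with h
  · rw [norm_pow]
    exact pow_le_one₀ (norm_nonneg _) (PadicInt.norm_le_one _)
  · rw [norm_zero]
    exact zero_le_one

/-- **`ω^i μ` is bounded by the bound of `μ`**: `‖(ω^i μ)(a + pⁿℤ_p)‖ ≤ C` if `‖μ‖ ≤ C`
(ultrametric inequality, `‖ω(b)^i‖ ≤ 1`). [cite: MazurTateTeitelbaum1986Invent, §I.11] -/
theorem norm_branchTwist_le {C : ℝ} (hC : ∀ (n : ℕ) (a : ZMod (p ^ n)), ‖μ n a‖ ≤ C) (i n : ℕ)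
    (a : ZMod (p ^ n)) : ‖branchTwist i μ n a‖ ≤ C := by
  classical
  have hC0 : 0 ≤ C := (norm_nonneg _).trans (hC 0 0)
  unfold branchTwist
  refine IsUltrametricDist.norm_sum_le_of_forall_le_of_nonneg hC0 fun b _ ↦ ?_
  rw [norm_mul]
  calc _ ≤ C * 1 := mul_le_mul (hC _ _) (norm_teichWeight_le_one p i _) (norm_nonneg _) hC0
    _ = C := mul_one C

/-- **`ω^i μ` is a distribution if `μ` is**:
`∑_{b ≡ a (pⁿ), b mod p^{n+1}} (ω^i μ)(b + p^{n+1}ℤ_p) = (ω^i μ)(a + pⁿℤ_p)`. Both sides equal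
`∑_{c ≡ a (pⁿ), c mod p^{e₀+n+1}} μ(c + p^{e₀+n+1}ℤ_p) ω(c)^i`: the left by merging the double sum,
the right by refining each `μ(b + p^{e₀+n}ℤ_p)` along the distribution relation of `μ`, the weight
`ω(c)^i = ω(b)^i` being constant on the fibre (Mazur–Tate–Teitelbaum 1986, §I.11 (11.1), §I.13).
[cite: MazurTateTeitelbaum1986Invent, §I.11 (11.1)] -/
theorem branchTwist_distribution
    (hdist : ∀ (n : ℕ) (a : ZMod (p ^ n)),
      ∑ b ∈ Finset.univ.filter (fun b : ZMod (p ^ (n + 1)) ↦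
        ZMod.castHom (pow_dvd_pow p n.le_succ) (ZMod (p ^ n)) b = a), μ (n + 1) b = μ n a)
    (i n : ℕ) (a : ZMod (p ^ n)) :
    ∑ b ∈ Finset.univ.filter (fun b : ZMod (p ^ (n + 1)) ↦
        ZMod.castHom (pow_dvd_pow p n.le_succ) (ZMod (p ^ n)) b = a), branchTwist i μ (n + 1) b =
      branchTwist i μ n a := by
  classical
  have h1 : n ≤ cyclotomicExponent p + n + 1 := by omega
  have h2 : cyclotomicExponent p ≤ cyclotomicExponent p + n + 1 := by omega
  have h3 : cyclotomicExponent p + n ≤ cyclotomicExponent p + n + 1 := by omega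
  -- the common value of both sides
  trans ∑ c ∈ Finset.univ.filter (fun c : ZMod (p ^ (cyclotomicExponent p + n + 1)) ↦
      ZMod.castHom (pow_dvd_pow p h1) (ZMod (p ^ n)) c = a),
    μ (cyclotomicExponent p + n + 1) c *
      teichWeight p i (ZMod.castHom (pow_dvd_pow p h2) (ZMod (p ^ cyclotomicExponent p)) c)
  · -- merge the double sum
    simp only [branchTwist]
    rw [← Finset.sum_fiberwise_of_maps_to
      (s := Finset.univ.filter (fun c : ZMod (p ^ (cyclotomicExponent p + n + 1)) ↦
        ZMod.castHom (pow_dvd_pow p h1) (ZMod (p ^ n)) c = a))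
      (t := Finset.univ.filter (fun b : ZMod (p ^ (n + 1)) ↦
        ZMod.castHom (pow_dvd_pow p n.le_succ) (ZMod (p ^ n)) b = a))
      (g := ZMod.castHom (pow_dvd_pow p (Nat.le_add_left (n + 1) (cyclotomicExponent p)))
        (ZMod (p ^ (n + 1))))]
    · refine Finset.sum_congr rfl fun b hb ↦ ?_
      refine Finset.sum_congr ?_ fun _ _ ↦ rfl
      ext c
      simp only [Finset.mem_filter, Finset.mem_univ, true_and, iff_and_self]
      intro hc
      rw [← (Finset.mem_filter.mp hb).2, ← hc, castHom_castHom_zmod]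
    · intro c hc
      simp only [Finset.mem_filter, Finset.mem_univ, true_and] at hc ⊢
      rw [castHom_castHom_zmod]
      exact hc
  · -- refine along the distribution relation of `μ`
    symm
    simp only [branchTwist]
    rw [← Finset.sum_fiberwise_of_maps_to
      (s := Finset.univ.filter (fun c : ZMod (p ^ (cyclotomicExponent p + n + 1)) ↦
        ZMod.castHom (pow_dvd_pow p h1) (ZMod (p ^ n)) c = a))
      (t := Finset.univ.filter (fun b : ZMod (p ^ (cyclotomicExponent p + n)) ↦
        ZMod.castHom (pow_dvd_pow p (Nat.le_add_left n (cyclotomicExponent p))) (ZMod (p ^ n)) b = a))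
      (g := ZMod.castHom (pow_dvd_pow p h3) (ZMod (p ^ (cyclotomicExponent p + n))))]
    · refine Finset.sum_congr rfl fun b hb ↦ ?_
      rw [← hdist (cyclotomicExponent p + n) b, Finset.sum_mul]
      refine Finset.sum_congr ?_ fun c hc ↦ ?_
      · ext c
        simp only [Finset.mem_filter, Finset.mem_univ, true_and, iff_and_self]
        intro hc
        rw [← (Finset.mem_filter.mp hb).2, ← hc, castHom_castHom_zmod]
      · have hcb : ZMod.castHom (pow_dvd_pow p (cyclotomicExponent p + n).le_succ)
            (ZMod (p ^ (cyclotomicExponent p + n))) c = b := by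
          have := (Finset.mem_filter.mp hc).2
          exact this
        rw [← hcb, castHom_castHom_zmod]
    · intro c hc
      simp only [Finset.mem_filter, Finset.mem_univ, true_and] at hc ⊢
      rw [castHom_castHom_zmod]
      exact hc

/-- **At levels `m ≥ e₀`, `(ω^i μ)(u + p^mℤ_p) = μ(u + p^mℤ_p) · ω(u)^i`** for a distribution `μ`:
the weight is constant on the fibre over `u` and the fibre sum of `μ` is `μ(u + p^mℤ_p)`
(`sum_fiber_of_distribution`). [cite: MazurTateTeitelbaum1986Invent, §I.13] -/
theorem branchTwist_apply_of_distribution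
    (hdist : ∀ (n : ℕ) (a : ZMod (p ^ n)),
      ∑ b ∈ Finset.univ.filter (fun b : ZMod (p ^ (n + 1)) ↦
        ZMod.castHom (pow_dvd_pow p n.le_succ) (ZMod (p ^ n)) b = a), μ (n + 1) b = μ n a)
    (i : ℕ) {m : ℕ} (hm : cyclotomicExponent p ≤ m) (u : ZMod (p ^ m)) :
    branchTwist i μ m u =
      μ m u * teichWeight p i (ZMod.castHom (pow_dvd_pow p hm) (ZMod (p ^ cyclotomicExponent p)) u) := by
  classical
  unfold branchTwist
  rw [← sum_fiber_of_distribution hdist (Nat.le_add_left m (cyclotomicExponent p)) u, Finset.sum_mul]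
  refine Finset.sum_congr rfl fun b hb ↦ ?_
  have hbu : ZMod.castHom (pow_dvd_pow p (Nat.le_add_left m (cyclotomicExponent p)))
      (ZMod (p ^ m)) b = u := (Finset.mem_filter.mp hb).2
  rw [← hbu, castHom_castHom_zmod]

end BranchTwist

/-! ### Weighted Riemann sums = Riemann sums of the twisted family -/

section Weighted

variable {μ : (n : ℕ) → ZMod (p ^ n) → ℚ_[p]} {i : ℕ} {RS : ℕ → ℕ → ℚ_[p]}
  (hRS : ∀ k n : ℕ, RS k n =
      ∑ᶠ ζ : rootsOfUnity (torsionOrder p) ℤ_[p], ∑ s : ZMod (p ^ n),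
        ((((ζ : ℤ_[p]ˣ) : ℤ_[p]) : ℚ_[p]) ^ i *
          μ (n + cyclotomicExponent p)
              (PadicInt.toZModPow (n + cyclotomicExponent p) ((ζ : ℤ_[p]ˣ) : ℤ_[p]) *
                (cyclotomicGenerator p : ZMod (p ^ (n + cyclotomicExponent p))) ^ s.val) *
            ((s.val.choose k : ℕ) : ℚ_[p])))

include hRS

/-- **The `ζ^i`-weighted Riemann sums of `μ` are the plain Riemann sums of `ω^i μ`**:
`∑_ζ ζ^i ∑_s μ(ζγˢ + p^{n+e₀}) (s choose k) = ∑_ζ ∑_s (ω^i μ)(ζγˢ + p^{n+e₀}) (s choose k)`, since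
`(ω^i μ)(ζγˢ) = μ(ζγˢ) ω(ζγˢ)^i` (`branchTwist_apply_of_distribution`) and `ω(ζγˢ)^i = ζ^i`
(`teichWeight_classMap`) (Mazur–Tate–Teitelbaum 1986, §I.13). [cite: MazurTateTeitelbaum1986Invent, §I.13] -/
theorem weightedRiemannSum_eq
    (hdist : ∀ (n : ℕ) (a : ZMod (p ^ n)),
      ∑ b ∈ Finset.univ.filter (fun b : ZMod (p ^ (n + 1)) ↦
        ZMod.castHom (pow_dvd_pow p n.le_succ) (ZMod (p ^ n)) b = a), μ (n + 1) b = μ n a)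
    (k n : ℕ) :
    RS k n = ∑ᶠ ζ : rootsOfUnity (torsionOrder p) ℤ_[p], ∑ s : ZMod (p ^ n),
      branchTwist i μ (n + cyclotomicExponent p)
          (PadicInt.toZModPow (n + cyclotomicExponent p) ((ζ : ℤ_[p]ˣ) : ℤ_[p]) *
            (cyclotomicGenerator p : ZMod (p ^ (n + cyclotomicExponent p))) ^ s.val) *
        ((s.val.choose k : ℕ) : ℚ_[p]) := by
  rw [hRS]
  refine finsum_congr fun ζ ↦ Finset.sum_congr rfl fun s _ ↦ ?_
  rw [branchTwist_apply_of_distribution hdist i (Nat.le_add_left _ n), teichWeight_classMap p i n ζ s]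
  ring

/-- **A uniform bound on the Riemann sums passes to the coefficient**: if `μ` is a bounded
distribution — so that the weighted Riemann sums converge, by `tendsto_riemannSum_of_distribution`
for the bounded distribution `ω^i μ` (`weightedRiemannSum_eq`, `branchTwist_distribution`,
`norm_branchTwist_le`) — and `‖RS k n‖ ≤ C'` for all `n`, then
`‖lim_n RS k n‖ ≤ C'` (closed balls are closed). Used at `p = 2`, where the `Δ = {±1}`-doubling gives
`C' = C·‖2‖₂`. [cite: MazurTateTeitelbaum1986Invent, §I.12] -/
theorem norm_limUnder_weightedRiemannSum_le_of_forall_le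
    (hdist : ∀ (n : ℕ) (a : ZMod (p ^ n)),
      ∑ b ∈ Finset.univ.filter (fun b : ZMod (p ^ (n + 1)) ↦
        ZMod.castHom (pow_dvd_pow p n.le_succ) (ZMod (p ^ n)) b = a), μ (n + 1) b = μ n a)
    {C : ℝ} (hC : ∀ (n : ℕ) (a : ZMod (p ^ n)), ‖μ n a‖ ≤ C) (k : ℕ) {C' : ℝ}
    (hC' : ∀ n, ‖RS k n‖ ≤ C') :
    ‖limUnder atTop fun n ↦ RS k n‖ ≤ C' :=
  le_of_tendsto (tendsto_riemannSum_of_distribution (μ := branchTwist i μ) (RS := RS)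
    (fun k n ↦ weightedRiemannSum_eq hRS hdist k n) (branchTwist_distribution hdist i)
    (norm_branchTwist_le hC i) k).norm (Eventually.of_forall hC')

end Weighted

/-! ### The three measures of the tree: plus, minus, one-term minus -/

section Branches

variable {N : ℕ} (f : CuspForm (CongruenceSubgroup.Gamma0 N) 2) (α : ℚ_[p])

/-- **The Riemann sums of the `ω^i`-branch of `L_p(f, α, T)` converge** to `padicLBranchCoeff f α i k`,
granted the distribution relation and a bound for `μ_{f,α}` (tree: `msdMeasure_distribution_holds`,
`norm_msdMeasure_le_one` / `exists_norm_msdMeasure_le_holds`). [cite: MazurTateTeitelbaum1986Invent, §I.13] -/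
theorem tendsto_padicLBranchRiemannSum
    (hdist : ∀ (n : ℕ) (a : ZMod (p ^ n)),
      ∑ b ∈ Finset.univ.filter (fun b : ZMod (p ^ (n + 1)) ↦
        ZMod.castHom (pow_dvd_pow p n.le_succ) (ZMod (p ^ n)) b = a), msdMeasure f α (n + 1) b =
        msdMeasure f α n a)
    {C : ℝ} (hC : ∀ (n : ℕ) (a : ZMod (p ^ n)), ‖msdMeasure f α n a‖ ≤ C) (i k : ℕ) :
    Tendsto (padicLBranchRiemannSum f α i k) atTop (𝓝 (padicLBranchCoeff f α i k)) :=
  tendsto_riemannSum_of_distribution (μ := branchTwist i (msdMeasure f α))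
    (RS := padicLBranchRiemannSum f α i)
    (fun k n ↦ weightedRiemannSum_eq (RS := padicLBranchRiemannSum f α i) (fun _ _ ↦ rfl) hdist k n)
    (branchTwist_distribution hdist i) (norm_branchTwist_le hC i) k

/-- **`‖[Tᵏ] L_p(f, α, ω^i, T)‖ ≤ C`** if `μ_{f,α}` is a distribution bounded by `C`.
[cite: MazurTateTeitelbaum1986Invent, §I.12–I.13] -/
theorem norm_padicLBranchCoeff_le
    (hdist : ∀ (n : ℕ) (a : ZMod (p ^ n)),
      ∑ b ∈ Finset.univ.filter (fun b : ZMod (p ^ (n + 1)) ↦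
        ZMod.castHom (pow_dvd_pow p n.le_succ) (ZMod (p ^ n)) b = a), msdMeasure f α (n + 1) b =
        msdMeasure f α n a)
    {C : ℝ} (hC : ∀ (n : ℕ) (a : ZMod (p ^ n)), ‖msdMeasure f α n a‖ ≤ C) (i k : ℕ) :
    ‖padicLBranchCoeff f α i k‖ ≤ C :=
  norm_limUnder_riemannSum_le_of_distribution (μ := branchTwist i (msdMeasure f α))
    (RS := padicLBranchRiemannSum f α i)
    (fun k n ↦ weightedRiemannSum_eq (RS := padicLBranchRiemannSum f α i) (fun _ _ ↦ rfl) hdist k n)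
    (branchTwist_distribution hdist i) (norm_branchTwist_le hC i) k

/-- **The Riemann sums of the minus `ω^i`-branch converge** to `padicLMinusBranchCoeff f α i k`,
granted the distribution relation and a bound for `μ⁻_{f,α}` (tree:
`sum_fiber_msdMinusMeasure_succ_eq_of_coeffField`, `norm_msdMinusMeasure_le_one`,
`norm_msdMinusMeasure_two_le_two`). [cite: MazurTateTeitelbaum1986Invent, §I.13] -/
theorem tendsto_padicLMinusBranchRiemannSum
    (hdist : ∀ (n : ℕ) (a : ZMod (p ^ n)),
      ∑ b ∈ Finset.univ.filter (fun b : ZMod (p ^ (n + 1)) ↦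
        ZMod.castHom (pow_dvd_pow p n.le_succ) (ZMod (p ^ n)) b = a), msdMinusMeasure f α (n + 1) b =
        msdMinusMeasure f α n a)
    {C : ℝ} (hC : ∀ (n : ℕ) (a : ZMod (p ^ n)), ‖msdMinusMeasure f α n a‖ ≤ C) (i k : ℕ) :
    Tendsto (padicLMinusBranchRiemannSum f α i k) atTop (𝓝 (padicLMinusBranchCoeff f α i k)) :=
  tendsto_riemannSum_of_distribution (μ := branchTwist i (msdMinusMeasure f α))
    (RS := padicLMinusBranchRiemannSum f α i)
    (fun k n ↦ weightedRiemannSum_eq (RS := padicLMinusBranchRiemannSum f α i) (fun _ _ ↦ rfl)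
      hdist k n)
    (branchTwist_distribution hdist i) (norm_branchTwist_le hC i) k

/-- **`‖[Tᵏ] L⁻_p(f, α, ω^i, T)‖ ≤ C`** if `μ⁻_{f,α}` is a distribution bounded by `C`.
[cite: MazurTateTeitelbaum1986Invent, §I.12–I.13] -/
theorem norm_padicLMinusBranchCoeff_le
    (hdist : ∀ (n : ℕ) (a : ZMod (p ^ n)),
      ∑ b ∈ Finset.univ.filter (fun b : ZMod (p ^ (n + 1)) ↦
        ZMod.castHom (pow_dvd_pow p n.le_succ) (ZMod (p ^ n)) b = a), msdMinusMeasure f α (n + 1) b =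
        msdMinusMeasure f α n a)
    {C : ℝ} (hC : ∀ (n : ℕ) (a : ZMod (p ^ n)), ‖msdMinusMeasure f α n a‖ ≤ C) (i k : ℕ) :
    ‖padicLMinusBranchCoeff f α i k‖ ≤ C :=
  norm_limUnder_riemannSum_le_of_distribution (μ := branchTwist i (msdMinusMeasure f α))
    (RS := padicLMinusBranchRiemannSum f α i)
    (fun k n ↦ weightedRiemannSum_eq (RS := padicLMinusBranchRiemannSum f α i) (fun _ _ ↦ rfl)
      hdist k n)
    (branchTwist_distribution hdist i) (norm_branchTwist_le hC i) k

/-- If moreover every Riemann sum of the minus `ω^i`-branch has norm `≤ C'`, so has the coefficient.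
[cite: MazurTateTeitelbaum1986Invent, §I.12–I.13] -/
theorem norm_padicLMinusBranchCoeff_le_of_forall_le
    (hdist : ∀ (n : ℕ) (a : ZMod (p ^ n)),
      ∑ b ∈ Finset.univ.filter (fun b : ZMod (p ^ (n + 1)) ↦
        ZMod.castHom (pow_dvd_pow p n.le_succ) (ZMod (p ^ n)) b = a), msdMinusMeasure f α (n + 1) b =
        msdMinusMeasure f α n a)
    {C : ℝ} (hC : ∀ (n : ℕ) (a : ZMod (p ^ n)), ‖msdMinusMeasure f α n a‖ ≤ C) (i k : ℕ) {C' : ℝ}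
    (hC' : ∀ n, ‖padicLMinusBranchRiemannSum f α i k n‖ ≤ C') :
    ‖padicLMinusBranchCoeff f α i k‖ ≤ C' :=
  norm_limUnder_weightedRiemannSum_le_of_forall_le (RS := padicLMinusBranchRiemannSum f α i)
    (fun _ _ ↦ rfl) hdist hC k hC'

/-- **The Riemann sums of the one-term minus `ω^i`-branch (`p ∣ N`) converge** to
`padicLMinusBranchMultCoeff f α i k`, granted the distribution relation and a bound for the one-term
`μ⁻_{f,α}` (tree: `sum_fiber_msdMinusMeasureMult_succ_eq_of_coeffField`).
[cite: MazurTateTeitelbaum1986Invent, §I.13] -/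
theorem tendsto_padicLMinusBranchMultRiemannSum
    (hdist : ∀ (n : ℕ) (a : ZMod (p ^ n)),
      ∑ b ∈ Finset.univ.filter (fun b : ZMod (p ^ (n + 1)) ↦
        ZMod.castHom (pow_dvd_pow p n.le_succ) (ZMod (p ^ n)) b = a),
          msdMinusMeasureMult f α (n + 1) b = msdMinusMeasureMult f α n a)
    {C : ℝ} (hC : ∀ (n : ℕ) (a : ZMod (p ^ n)), ‖msdMinusMeasureMult f α n a‖ ≤ C) (i k : ℕ) :
    Tendsto (padicLMinusBranchMultRiemannSum f α i k) atTop
      (𝓝 (padicLMinusBranchMultCoeff f α i k)) :=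
  tendsto_riemannSum_of_distribution (μ := branchTwist i (msdMinusMeasureMult f α))
    (RS := padicLMinusBranchMultRiemannSum f α i)
    (fun k n ↦ weightedRiemannSum_eq (RS := padicLMinusBranchMultRiemannSum f α i) (fun _ _ ↦ rfl)
      hdist k n)
    (branchTwist_distribution hdist i) (norm_branchTwist_le hC i) k

/-- **`‖[Tᵏ] L⁻_p(f, α, ω^i, T)‖ ≤ C'` for the one-term minus branch at `p ∣ N`** if `μ⁻_{f,α}` is a
distribution bounded by `C` and every Riemann sum has norm `≤ C'`.
[cite: MazurTateTeitelbaum1986Invent, §I.12–I.13] -/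
theorem norm_padicLMinusBranchMultCoeff_le_of_forall_le
    (hdist : ∀ (n : ℕ) (a : ZMod (p ^ n)),
      ∑ b ∈ Finset.univ.filter (fun b : ZMod (p ^ (n + 1)) ↦
        ZMod.castHom (pow_dvd_pow p n.le_succ) (ZMod (p ^ n)) b = a),
          msdMinusMeasureMult f α (n + 1) b = msdMinusMeasureMult f α n a)
    {C : ℝ} (hC : ∀ (n : ℕ) (a : ZMod (p ^ n)), ‖msdMinusMeasureMult f α n a‖ ≤ C) (i k : ℕ)
    {C' : ℝ} (hC' : ∀ n, ‖padicLMinusBranchMultRiemannSum f α i k n‖ ≤ C') :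
    ‖padicLMinusBranchMultCoeff f α i k‖ ≤ C' :=
  norm_limUnder_weightedRiemannSum_le_of_forall_le (RS := padicLMinusBranchMultRiemannSum f α i)
    (fun _ _ ↦ rfl) hdist hC k hC'

/-- **`‖[Tᵏ] L⁻_p(f, α, ω^i, T)‖ ≤ C`** for the one-term minus branch at `p ∣ N` if `μ⁻_{f,α}` is a
distribution bounded by `C`. [cite: MazurTateTeitelbaum1986Invent, §I.12–I.13] -/
theorem norm_padicLMinusBranchMultCoeff_le
    (hdist : ∀ (n : ℕ) (a : ZMod (p ^ n)),
      ∑ b ∈ Finset.univ.filter (fun b : ZMod (p ^ (n + 1)) ↦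
        ZMod.castHom (pow_dvd_pow p n.le_succ) (ZMod (p ^ n)) b = a),
          msdMinusMeasureMult f α (n + 1) b = msdMinusMeasureMult f α n a)
    {C : ℝ} (hC : ∀ (n : ℕ) (a : ZMod (p ^ n)), ‖msdMinusMeasureMult f α n a‖ ≤ C) (i k : ℕ) :
    ‖padicLMinusBranchMultCoeff f α i k‖ ≤ C :=
  norm_limUnder_riemannSum_le_of_distribution (μ := branchTwist i (msdMinusMeasureMult f α))
    (RS := padicLMinusBranchMultRiemannSum f α i)
    (fun k n ↦ weightedRiemannSum_eq (RS := padicLMinusBranchMultRiemannSum f α i) (fun _ _ ↦ rfl)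
      hdist k n)
    (branchTwist_distribution hdist i) (norm_branchTwist_le hC i) k

end Branches

end Literature.NumberTheory.EllipticCurves

end
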